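import Literature.Analysis.FluidPDE.CKNTheoremBViscosity
import Literature.Analysis.FluidPDE.CKNOneScaleFromRRS
import Literature.Analysis.FluidPDE.CKNLocalRegularityRRSStep2
import HarnessLib

/-!
# Caffarelli–Kohn–Nirenberg 1982, Theorem B with trust base `{RRS2016.lemma15_12}`

Analysis/FluidPDE file in the decomposition of the named fact
`Literature.Analysis.FluidPDE.ckn_partial_regularity` (`PartialRegularity.lean`, ns.S11:
Caffarelli–Kohn–Nirenberg 1982, Theorem B — the singular set of a suitable weak solution with
viscosity `ν > 0` and CKN force has `𝒫¹(S) = 0`). It only composes accepted reductions, so that the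
dependency of Theorem B on the one remaining named fact of the chain is a single checked term:

* `CKNTheoremB.lean` + `CKNTheoremBViscosity.lean`:
  `ckn_partial_regularity_of_epsilon_regularity : ckn_epsilon_regularity → ckn_partial_regularity`
  (CKN §6, the Vitali covering argument of the proof of Theorem B from Proposition 2, and the
  normalisation `ν = 1` of §1);
* `CKNOneScaleFromRRS.lean`:
  `ckn_epsilon_regularity_of_theorem15_3_force : RRS2016.theorem15_3_force → ckn_epsilon_regularity`
  (Proposition 2 from Proposition 1 — in tree, Robinson–Rodrigo–Sadowski's first local regularity
  theorem with force, Thm. 15.3 — through the proved local energy, pressure and interpolation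
  estimates, `ckn_epsilon_regularity_of_estimates`);
* `CKNLocalRegularityRRSStep2.lean`:
  `RRS2016.theorem15_3_force_of_lemma15_12 : RRS2016.lemma15_12 → RRS2016.theorem15_3_force`
  (all four steps of the induction of RRS pp. 220–226 are proved; the local pressure estimate,
  RRS Lemma 15.12 — Calderón–Zygmund on `L^{3/2}` — is the named fact `RRS2016.lemma15_12` of
  `CKNLocalRegularityRRS.lean`).

Hence `ckn_partial_regularity_of_theorem15_3_force` and
`ckn_partial_regularity_of_lemma15_12 : RRS2016.lemma15_12 → ckn_partial_regularity`: once
`RRS2016.lemma15_12` is discharged, `ckn_partial_regularity_holds` is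
`ckn_partial_regularity_of_lemma15_12 RRS2016.lemma15_12_holds`. The heavy imports of the
ε-regularity chain are confined to this file (`CKNTheoremBViscosity.lean` stays light).

## References

* L. Caffarelli, R. Kohn, L. Nirenberg, *Partial regularity of suitable weak solutions of the
  Navier–Stokes equations*, Comm. Pure Appl. Math. 35 (1982), 771–831: Proposition 1,
  Proposition 2, Theorem B (proof in §6). [CaffarelliKohnNirenberg1982] [CKN1982]
* J. C. Robinson, J. L. Rodrigo, W. Sadowski, *The Three-Dimensional Navier–Stokes Equations*,
  CUP (2016), Thm. 15.3 (pp. 220–226), Lemma 15.12 (p. 232), Thm. 16.2 (p. 245).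
  [RobinsonRodrigoSadowski2016]
-/

noncomputable section

namespace Literature.Analysis.FluidPDE

/-- **Theorem B from the first local regularity theorem with force** (Caffarelli–Kohn–Nirenberg
1982: Theorem B from Proposition 2 (§6, any viscosity by §1), Proposition 2 from Proposition 1;
in tree Proposition 1 is Robinson–Rodrigo–Sadowski's Thm. 15.3 with force,
`RRS2016.theorem15_3_force`): composition of `ckn_partial_regularity_of_epsilon_regularity` and
`ckn_epsilon_regularity_of_theorem15_3_force`.
[cite: CaffarelliKohnNirenberg1982, Theorem B (proof, §6) and Proposition 2] -/
theorem ckn_partial_regularity_of_theorem15_3_force (h : RRS2016.theorem15_3_force) :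
    ckn_partial_regularity :=
  ckn_partial_regularity_of_epsilon_regularity (ckn_epsilon_regularity_of_theorem15_3_force h)

/-- **Theorem B with trust base `{RRS2016.lemma15_12}`**: Caffarelli–Kohn–Nirenberg's Theorem B
for every viscosity `ν > 0` (`ckn_partial_regularity`, ns.S11) follows from the single named fact
`RRS2016.lemma15_12` (the local pressure estimate, Robinson–Rodrigo–Sadowski 2016, Lemma 15.12),
every other step of the chain Lemma 15.12 → Thm. 15.3 (with force) → Proposition 2 → Theorem B
being proved in tree (`RRS2016.theorem15_3_force_of_lemma15_12`,
`ckn_partial_regularity_of_theorem15_3_force`).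
[cite: CaffarelliKohnNirenberg1982, Theorem B (proof, §6)] -/
theorem ckn_partial_regularity_of_lemma15_12 (h12 : RRS2016.lemma15_12) :
    ckn_partial_regularity :=
  ckn_partial_regularity_of_theorem15_3_force (RRS2016.theorem15_3_force_of_lemma15_12 h12)

end Literature.Analysis.FluidPDE
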